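import Summits.QuantumFields.BalabanUV.T4Continuum.Support.ShellMeasureLandauEndRayStokesAssembledDecay
import Summits.QuantumFields.BalabanUV.T4Continuum.Support.ShellMeasureThresholdUnits

/-!
# `T4Continuum.ShellMeasureLiveEndOneCallSlot` — row S92 file 1: THE LIVE-LEVEL END-II OF RECORD OVER THE INDEXED FAMILIES,
# IN THRESHOLD UNITS (S80 f3 ∘ the γ8 unit change S90), for BOTH runs and every slot — END-I's `hacA`∕`hacB` shape
(cell `pub-balaban`, sub-cell `t4`, spine estimate NE7c (node U5b); NE7c ROUND-2 crew, unit `b2b-balaban-t4-ne7c-formalise-leaf-09`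
gen 12; owner table row **S92** (R-ne7cp1-g33-3 (b); CLAIM journal l.18910, SHAPE∕Q l.18955); ADDITIVE — imports S80 f3
`ShellMeasureLandauEndRayStokesAssembledDecay` (p229913) and S90 `ShellMeasureThresholdUnits` (p229839) ONLY; [folklore]; 0 `def`,
0 `def … : Prop`, 0 sorry, 0 citation tags; the statement is GENERATED from S80 f3's by indexing every binder — script in
`HOME/b2b-balaban-t4-ne7c-formalise-leaf-09/g12/s92/`)

HONEST FRAMING.  Finite four-torus programme, rung (B)+1 only — NOT infinite volume, NOT a mass gap, NOT the Clay problem, NOT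
summit progress; (B), `BetaPertHyp`, (B^μ) not consumed.  NE7c (`T4IndicatorShell.ShellWeightBound`) is NOT PRINTED in
[Balaban 1983–89] and NOT PROVED; «NE7c ⇐ the named binders» (trigger c3): every binder below is DISPLAYED, asserted by nobody;
no estimate of Bałaban's is discharged; (M1) realized ≠ NE7c.  Equation numbers in comments LOCATE displayed shapes, not
citations.  HONEST DEPENDENCY (cell): continuum YM on T⁴ ⇐ BetaPertH ∧ nine spine estimates (0/9 proved); BetaPertH ⇐ (D1) ∧ (D4)
∧ CAP+tail; G-an2-4 gates asym, D1 and NE2/3/4.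

WHAT IS PROVED ([folklore]).  **`hac_live_of_assembled_decay`**: for a run index `r : Bool` (run A = `true`, run B = `false`),
comparison index `K`, source parameter `t` and slot `s : σ`, with the slot on its own lattice `(P r K s, jl r K s)` (lattice level
`jl`; END-I level `lvl`), EVERY binder of S80 f3 `slotAC_realized_su2_landauChart_assembled_decay` as a FAMILY — the 26 TYPE
families ((T1)∕(T2)∕(T3) spaces, index types, S78's probability space) and the chart geometry (`Tr`, `Λ`, `m₀`, `e`) by
`(r, K, s)`, every other object (scheme operators, decay kernels, read-outs, real structure, `F`, `u`, `Jco`, `W`, `ctr`, `U₀`,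
[dict], S78's `μ g Aex`, lower bounds) by `(r, K, t, s)`, hypotheses quantified unguarded over exactly the indices they mention;
Bałaban's UNIFORM NUMBERS SHARED across runs and slots (owner R-ne7cp1-g33-4 (Q2)); the profiles `ε η ρ β : Bool → ℕ → ℝ` (age
threshold `ε r (K − lvl r K s)`, fine scale `η r (jl r K s)` and coupling `β r (jl r K s)` by LATTICE level, width `ρ r (lvl r K s)`)
⟹ `∀ r K t s, SlotAntiConcentration ((fieldMeasure (P r K s) (jl r K s) SU2).withDensity (F r K t s)) (u r K t s ∕ η r (jl r K s)²)
(ε r (K − lvl r K s)) (ρ r (lvl r K s)) (S80 f3's slot constant at (r, K, t, s))` — ONE call of S80 f3 at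
`(εθ, η) := (ε r (K − lvl r K s), η r (jl r K s))`, then S90 `slotAntiConcentration_thresholdUnits`.  File 2
`ShellMeasureLiveEndOneCall.shellWeightBound_live_oneCall` feeds it to END-I as `hacA := · true`, `hacB := · false`.  Renamings
forced by END-I's names: tree `Tr`, centre `ctr`, classifier index type `ιc`, S78's exponent `Aex`, (SM) letter `zs`.
-/

noncomputable section

open Set Metric NormedSpace MeasureTheory Function Finset
open scoped ENNReal

namespace Summit.QuantumFields.BalabanUV.T4Continuum.ShellMeasureLiveEndOneCallSlot

open Literature.MathematicalPhysics.QuantumFieldTheory.Balaban1983to89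
open B11Prop6Scheme (Prop4Hyp)
open GaugeField (GaugeInvariant)
open T4ShellMeasure (SlotAntiConcentration)
open T4CubePoincare (cube)
open T4CubeChartGnomonic (SU2)
open T4CubeChartExp (expFibreChart)
open T4TreeGaugeFixing (NoClosedLoop fixTo)
open T4ShellMeasurePlaquette (expTail₂)
open ShellMeasureLevelAssembly (classifier)
open ShellMeasureMultiGridNorms (WSup)
open ShellMeasurePinnedNorm (pinW)
open ShellMeasureDecayKernelSums (kerOp)
open ShellMeasureLandauHolonomy (solAt landauExp)
open ShellMeasureLandauHolonomyChart (holOf cplx)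
open ShellMeasureLandauHolonomySkew (readOutReal)
open ShellMeasureThresholdUnits (slotAntiConcentration_thresholdUnits)
open ShellMeasureLandauEndRayStokesAssembledDecay (slotAC_realized_su2_landauChart_assembled_decay)

open scoped Matrix.Norms.L2Operator

variable {σ : Type*} {n : Type*} [Fintype n] [DecidableEq n] [Nonempty n]

/-- **THE LIVE-LEVEL END-II OF RECORD IN THRESHOLD UNITS, OVER THE INDEXED FAMILIES** (row S92 file 1; see the module
docstring).  CONDITIONAL on every displayed binder; nothing PRINTED is asserted; NOT Bałaban's minimiser; NE7c NOT PROVED.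
[folklore] -/
theorem hac_live_of_assembled_decay
    (P : Bool → ℕ → σ → Params) (jl lvl : Bool → ℕ → σ → ℕ) [∀ r K s, DecidableEq (PBond (P r K s) (jl r K s))]
    {ε η ρ β : Bool → ℕ → ℝ} (hη : ∀ r j, 0 < η r j) (hε : ∀ r a, 0 < ε r a) (hρ0 : ∀ r j, 0 ≤ ρ r j)
    {𝒴 𝒴' 𝒳 𝒵 ℬ : Bool → ℕ → σ → Type*} [∀ r K s, NormedAddCommGroup (𝒴 r K s)] [∀ r K s, NormedSpace ℂ (𝒴 r K s)]
    [∀ r K s, CompleteSpace (𝒴 r K s)] [∀ r K s, NormedAddCommGroup (𝒴' r K s)] [∀ r K s, NormedSpace ℂ (𝒴' r K s)]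
    [∀ r K s, NormedAddCommGroup (𝒳 r K s)] [∀ r K s, NormedSpace ℂ (𝒳 r K s)] [∀ r K s, CompleteSpace (𝒳 r K s)]
    [∀ r K s, NormedAddCommGroup (𝒵 r K s)] [∀ r K s, NormedSpace ℂ (𝒵 r K s)] [∀ r K s, NormedAddCommGroup (ℬ r K s)]
    [∀ r K s, NormedSpace ℂ (ℬ r K s)] {Tr : ∀ r K s, Finset (PBond (P r K s) (jl r K s))}
    (hT : ∀ r K s, NoClosedLoop (Tr r K s)) (U₀ : ∀ r K (t : ℝ) s, GaugeField (P r K s) (jl r K s) SU2)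
    (Λ : ∀ r K s, Finset (PBond (P r K s) (jl r K s))) {m₀ : Bool → ℕ → σ → ℕ}
    (e : ∀ r K s, ↥(Λ r K s) × Fin 3 ≃ Fin (m₀ r K s)) {S : ℝ} (hS : 0 < S) (hSπ : 3 * S ^ 2 < Real.pi ^ 2)
    (ctr : ∀ r K (t : ℝ) s, GaugeField (P r K s) (jl r K s) SU2 → GaugeField (P r K s) (jl r K s) SU2)
    {F : ∀ r K (t : ℝ) s, GaugeField (P r K s) (jl r K s) SU2 → ℝ≥0∞} (hF : ∀ r K t s, Measurable (F r K t s))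
    (hFi : ∀ r K t s, GaugeInvariant (F r K t s))
    (hFsupp : ∀ r K t s, ∀ V y, F r K t s (fixTo (Tr r K s) (U₀ r K t s) (updateFinset V (Λ r K s) y)) ≠ 0 → ∀ b (hb : b ∈ Λ r K
      s), dist1 ((ctr r K t s V b)⁻¹ * y ⟨b, hb⟩) ≤ 2 * Real.sin (S / 2))
    {u : ∀ r K (t : ℝ) s, GaugeField (P r K s) (jl r K s) SU2 → ℝ} (hu : ∀ r K t s, Measurable (u r K t s))
    (hui : ∀ r K t s, GaugeInvariant (u r K t s)) {ιc : Bool → ℕ → σ → Type*} {Pu : ∀ r K (t : ℝ) s, Finset (ιc r K s)}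
    (hPu : ∀ r K t s, (Pu r K t s).Nonempty)
    (W : ∀ r K (t : ℝ) s, GaugeField (P r K s) (jl r K s) SU2 → Set (Fin (m₀ r K s) → ℝ))
    (Jco : ∀ r K (t : ℝ) s, GaugeField (P r K s) (jl r K s) SU2 → (Fin (m₀ r K s) → ℝ) → ℝ≥0∞) {δ : ℝ}
    (𝒢 : ∀ r K (t : ℝ) s, GaugeField (P r K s) (jl r K s) SU2 → (𝒵 r K s →L[ℂ] (𝒴 r K s)))
    (W𝒱 : ∀ r K (t : ℝ) s, GaugeField (P r K s) (jl r K s) SU2 → 𝒴 r K s → 𝒵 r K s) {B₀ C₄ a₃ ε₄ : ℝ}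
    (h𝒢 : ∀ r K t s, ∀ V f, ‖𝒢 r K t s V f‖ ≤ B₀ * ‖f‖) (hW : ∀ r K t s, ∀ V, Prop4Hyp (W𝒱 r K t s V) C₄ a₃) (hB₀ : 0 < B₀)
    (hC₄ : 0 ≤ C₄) (hε₄ : 0 ≤ ε₄) {dL C₁ B₃ ε₁ : ℝ} (hdL : 0 ≤ dL) (hC₁ : 0 ≤ C₁) (hε₁ : 0 ≤ ε₁) (hB₃ : dL ≤ B₃)
    (h1 : 2 * B₀ * C₁ * B₃ * ε₁ ≤ ε₄) (h2 : 4 * ε₄ ≤ a₃) (h3 : 16 * B₀ * C₄ * ε₄ ≤ 1)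
    (H₁ : ∀ r K (t : ℝ) s, GaugeField (P r K s) (jl r K s) SU2 → (ℬ r K s →L[ℂ] (𝒴 r K s)))
    (hH₁ : ∀ r K t s, ∀ V B, ‖H₁ r K t s V B‖ ≤ B₀ * ‖B‖)
    (Φ : ∀ r K (t : ℝ) s, GaugeField (P r K s) (jl r K s) SU2 → (Fin (m₀ r K s) → ℂ) → ℬ r K s) {rΦ : ℝ}
    (hΦd : ∀ r K t s, ∀ V, DifferentiableOn ℂ (Φ r K t s V) (ball 0 rΦ)) (hΦ0 : ∀ r K t s, ∀ V, Φ r K t s V 0 = 0)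
    (hΦ : ∀ r K t s, ∀ V, ∀ z ∈ ball (0 : Fin (m₀ r K s) → ℂ) rΦ, ‖Φ r K t s V z‖ < 2 * dL * C₁ * ε₁) (hSr : S < rΦ)
    (Cf : ∀ r K (t : ℝ) s, GaugeField (P r K s) (jl r K s) SU2 → 𝒴' r K s → 𝒳 r K s) {C₂ RC : ℝ} (hC₂ : 0 ≤ C₂)
    (hCq : ∀ r K t s, ∀ V, ∀ Z : 𝒴' r K s, ‖Z‖ < RC → ‖Cf r K t s V Z‖ ≤ C₂ * ‖Z‖ ^ 2)
    (hCd : ∀ r K t s, ∀ V, DifferentiableOn ℂ (Cf r K t s V) (ball 0 RC))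
    (ιs : ∀ r K (t : ℝ) s, GaugeField (P r K s) (jl r K s) SU2 → (𝒴 r K s →L[ℂ] (𝒴' r K s)))
    (hι : ∀ r K t s, ∀ V Y, ‖ιs r K t s V Y‖ ≤ ‖Y‖)
    (Hop : ∀ r K (t : ℝ) s, GaugeField (P r K s) (jl r K s) SU2 → (𝒳 r K s →L[ℂ] (𝒴 r K s)))
    (hH : ∀ r K t s, ∀ V X, ‖Hop r K t s V X‖ ≤ B₀ * ‖X‖) {ε₃ : ℝ} (h18 : 18 * C₂ * B₀ * ε₃ ≤ 1)
    (hcoup : ε₄ + B₀ * (2 * dL * C₁ * ε₁) ≤ ε₃) (h3R : 3 * ε₃ ≤ RC)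
    (ℓs : ∀ r K (t : ℝ) s, ιc r K s → List (𝒴 r K s →L[ℂ] Matrix n n ℂ)) {κr : ℝ} (hκ : 0 ≤ κr)
    (hℓ : ∀ r K t s, ∀ p ∈ Pu r K t s, ∀ ℓ ∈ ℓs r K t s p, ∀ Y, ‖ℓ Y‖ ≤ κr * ‖Y‖) {m : ℕ}
    (hlen : ∀ r K t s, ∀ p ∈ Pu r K t s, (ℓs r K t s p).length ≤ m) {κc : ℝ} (hκc : 0 ≤ κc)
    (hcurl : ∀ r K t s, ∀ p ∈ Pu r K t s, ∀ Y, ‖((ℓs r K t s p).map fun ℓ => ℓ Y).sum‖ ≤ κc * ‖Y‖)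
    -- ══ (T2) THE WILSON SLOT'S SUPPLIER DATA AT THE READING OF RECORD (file 4 …
    {Λw Λz Λw' Λx Λb 𝔖 : Bool → ℕ → σ → Type*} [∀ r K s, Fintype (Λw r K s)] [∀ r K s, DecidableEq (Λw r K s)]
    [∀ r K s, Fintype (Λz r K s)] [∀ r K s, Fintype (Λw' r K s)] [∀ r K s, Fintype (Λx r K s)] [∀ r K s, Fintype (Λb r K s)]
    {𝔄w ℭ 𝔄' 𝔅 𝔇 : Bool → ℕ → σ → Type*} [∀ r K s, NormedAddCommGroup (𝔄w r K s)] [∀ r K s, NormedSpace ℂ (𝔄w r K s)]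
    [∀ r K s, CompleteSpace (𝔄w r K s)] [∀ r K s, NormedAddCommGroup (ℭ r K s)] [∀ r K s, NormedSpace ℂ (ℭ r K s)]
    [∀ r K s, NormedAddCommGroup (𝔄' r K s)] [∀ r K s, NormedSpace ℂ (𝔄' r K s)] [∀ r K s, NormedAddCommGroup (𝔅 r K s)]
    [∀ r K s, NormedSpace ℂ (𝔅 r K s)] [∀ r K s, CompleteSpace (𝔅 r K s)] [∀ r K s, NormedAddCommGroup (𝔇 r K s)]
    [∀ r K s, NormedSpace ℂ (𝔇 r K s)] {δw : ℝ} (hδw : 0 ≤ δw) (ϖw : ∀ r K (t : ℝ) s, 𝔖 r K s → ℝ)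
    (dis : ∀ r K (t : ℝ) s, 𝔖 r K s → 𝔖 r K s → ℝ) (hϖw : ∀ r K t s, ∀ x y, ϖw r K t s x ≤ ϖw r K t s y + dis r K t s x y)
    (pos : ∀ r K (t : ℝ) s, Λw r K s → 𝔖 r K s) (posz : ∀ r K (t : ℝ) s, Λz r K s → 𝔖 r K s)
    (pos' : ∀ r K (t : ℝ) s, Λw' r K s → 𝔖 r K s) (posx : ∀ r K (t : ℝ) s, Λx r K s → 𝔖 r K s)
    (posb : ∀ r K (t : ℝ) s, Λb r K s → 𝔖 r K s)
    (k𝒢 : ∀ r K (t : ℝ) s, GaugeField (P r K s) (jl r K s) SU2 → Λw r K s → Λz r K s → (ℭ r K s →L[ℂ] (𝔄w r K s)))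
    (kι : ∀ r K (t : ℝ) s, GaugeField (P r K s) (jl r K s) SU2 → Λw' r K s → Λw r K s → (𝔄w r K s →L[ℂ] (𝔄' r K s)))
    (kH : ∀ r K (t : ℝ) s, GaugeField (P r K s) (jl r K s) SU2 → Λw r K s → Λx r K s → (𝔅 r K s →L[ℂ] (𝔄w r K s)))
    (kH₁ : ∀ r K (t : ℝ) s, GaugeField (P r K s) (jl r K s) SU2 → Λw r K s → Λb r K s → (𝔇 r K s →L[ℂ] (𝔄w r K s)))
    {c𝒢 δ𝒢 M𝒢 cι δι Mι cH δH MH cH₁ δH₁ MH₁ : ℝ} (hc𝒢 : 0 ≤ c𝒢) (hM𝒢 : 0 ≤ M𝒢)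
    (hk𝒢 : ∀ r K t s, ∀ V c b', ‖k𝒢 r K t s V c b'‖ ≤ c𝒢 * Real.exp (-(δ𝒢 * dis r K t s (pos r K t s c) (posz r K t s b'))))
    (hM𝒢' : ∀ r K t s, ∀ x, ∑ b', Real.exp (-((δ𝒢 - δw) * dis r K t s x (posz r K t s b'))) ≤ M𝒢) (hcι : 0 ≤ cι) (hMι : 0 ≤ Mι)
    (hkι : ∀ r K t s, ∀ V c b', ‖kι r K t s V c b'‖ ≤ cι * Real.exp (-(δι * dis r K t s (pos' r K t s c) (pos r K t s b'))))
    (hMι' : ∀ r K t s, ∀ x, ∑ b', Real.exp (-((δι - δw) * dis r K t s x (pos r K t s b'))) ≤ Mι) (hcH : 0 ≤ cH) (hMH : 0 ≤ MH)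
    (hkH : ∀ r K t s, ∀ V c b', ‖kH r K t s V c b'‖ ≤ cH * Real.exp (-(δH * dis r K t s (pos r K t s c) (posx r K t s b'))))
    (hMH' : ∀ r K t s, ∀ x, ∑ b', Real.exp (-((δH - δw) * dis r K t s x (posx r K t s b'))) ≤ MH) (hcH₁ : 0 ≤ cH₁)
    (hMH₁ : 0 ≤ MH₁)
    (hkH₁ : ∀ r K t s, ∀ V c b', ‖kH₁ r K t s V c b'‖ ≤ cH₁ * Real.exp (-(δH₁ * dis r K t s (pos r K t s c) (posb r K t s b'))))
    (hMH₁' : ∀ r K t s, ∀ x, ∑ b', Real.exp (-((δH₁ - δw) * dis r K t s x (posb r K t s b'))) ≤ MH₁)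
    -- the flat lists (P2)∕(P4)∕(118)∕(121)∕(103)∕(75)-TYPE∕(44) at radius `RCw` with `6(ε₄w + B₀w·bw) ≤ RCw`∕scal …
    (W𝒱w : ∀ r K (t : ℝ) s, GaugeField (P r K s) (jl r K s) SU2 → (Λw r K s → 𝔄w r K s) → (Λz r K s → ℭ r K s))
    {B₀w C₄w a₃w ε₄w bw : ℝ} (h𝒢w : ∀ r K t s, ∀ V f, ‖kerOp (k𝒢 r K t s V) f‖ ≤ B₀w * ‖f‖)
    (hWw : ∀ r K t s, ∀ V, Prop4Hyp (W𝒱w r K t s V) C₄w a₃w) (hB₀w : 0 < B₀w) (hC₄w : 0 ≤ C₄w) (hε₄w : 0 ≤ ε₄w)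
    (hdomw : 2 * (ε₄w + B₀w * bw) ≤ a₃w) (hselfw : B₀w * C₄w * (ε₄w + B₀w * bw) ^ 2 ≤ ε₄w)
    (hcontrw : 4 * B₀w * C₄w * (ε₄w + B₀w * bw) < 1) (hH₁w : ∀ r K t s, ∀ V B, ‖kerOp (kH₁ r K t s V) B‖ ≤ B₀w * ‖B‖)
    (Φw : ∀ r K (t : ℝ) s, GaugeField (P r K s) (jl r K s) SU2 → (Fin (m₀ r K s) → ℂ) → (Λb r K s → 𝔇 r K s)) {rΦw : ℝ}
    (hΦdw : ∀ r K t s, ∀ V, DifferentiableOn ℂ (Φw r K t s V) (ball 0 rΦw)) (hΦ0w : ∀ r K t s, ∀ V, Φw r K t s V 0 = 0)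
    (hΦbw : ∀ r K t s, ∀ V, ∀ z ∈ ball (0 : Fin (m₀ r K s) → ℂ) rΦw, ‖Φw r K t s V z‖ < bw) (h2Sw : 2 * S ≤ rΦw)
    (Cw : ∀ r K (t : ℝ) s, GaugeField (P r K s) (jl r K s) SU2 → (Λw' r K s → 𝔄' r K s) → (Λx r K s → 𝔅 r K s)) {C₂w RCw : ℝ}
    (hC₂w : 0 ≤ C₂w) (hCqw : ∀ r K t s, ∀ V, ∀ Z : Λw' r K s → 𝔄' r K s, ‖Z‖ < RCw → ‖Cw r K t s V Z‖ ≤ C₂w * ‖Z‖ ^ 2)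
    (hCdw : ∀ r K t s, ∀ V, DifferentiableOn ℂ (Cw r K t s V) (ball 0 RCw))
    (hιw : ∀ r K t s, ∀ V Y, ‖kerOp (kι r K t s V) Y‖ ≤ ‖Y‖) (hHw : ∀ r K t s, ∀ V X, ‖kerOp (kH r K t s V) X‖ ≤ B₀w * ‖X‖)
    (hqw : 9 * C₂w * B₀w * (ε₄w + B₀w * bw) < 1) (hRCw : 6 * (ε₄w + B₀w * bw) ≤ RCw)
    -- localities with reaches, the block support, the two contraction numbers (DISPLAYED arithmetic on the decay …
    (NW : ∀ r K (t : ℝ) s, Λz r K s → Λw r K s → Prop)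
    (hlocW : ∀ r K t s, ∀ V, ∀ A A' : Λw r K s → 𝔄w r K s, ∀ c', (∀ b', NW r K t s c' b' → A b' = A' b') → W𝒱w r K t s V A c' =
      W𝒱w r K t s V A' c')
    {rW : ℝ} (hreachW : ∀ r K t s, ∀ c' b', NW r K t s c' b' → ϖw r K t s (posz r K t s c') - rW ≤ ϖw r K t s (pos r K t s b'))
    (NC : ∀ r K (t : ℝ) s, Λx r K s → Λw' r K s → Prop)
    (hlocC : ∀ r K t s, ∀ V, ∀ A A' : Λw' r K s → 𝔄' r K s, ∀ c', (∀ b', NC r K t s c' b' → A b' = A' b') → Cw r K t s V A c' =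
      Cw r K t s V A' c')
    {rC : ℝ} (hreachC : ∀ r K t s, ∀ c' b', NC r K t s c' b' → ϖw r K t s (posx r K t s c') - rC ≤ ϖw r K t s (pos' r K t s b'))
    (hsupp : ∀ r K t s, ∀ V, ∀ z : Fin (m₀ r K s) → ℂ, ∀ i, 0 < ϖw r K t s (posb r K t s i) → Φw r K t s V z i = 0)
    (hqW : c𝒢 * M𝒢 * (2 * C₄w * a₃w * Real.exp (δw * rW)) < 1)
    (hk : 2 * C₂w * RCw * Real.exp (δw * rC) * (cι * Mι) * (cH * MH) < 1)
    -- weight plaquettes; read-outs BLIND off located supports, FLAT op-norms, curl op-norm (DISPLAYED; `κ_c ∝ η²` …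
    {𝔭 : Bool → ℕ → σ → Type*} (Pw : ∀ r K (t : ℝ) s, Finset (𝔭 r K s))
    (ℓw : ∀ r K (t : ℝ) s, 𝔭 r K s → List ((Λw r K s → 𝔄w r K s) →L[ℂ] Matrix n n ℂ))
    (suppw : ∀ r K (t : ℝ) s, 𝔭 r K s → Finset (Λw r K s)) (ϖPw : ∀ r K (t : ℝ) s, 𝔭 r K s → ℝ)
    (hblindw : ∀ r K t s, ∀ p ∈ Pw r K t s, ∀ ℓ ∈ ℓw r K t s p, ∀ A A' : Λw r K s → 𝔄w r K s, (∀ b' ∈ suppw r K t s p, A b' = A'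
      b') → ℓ A = ℓ A')
    (hdepthw : ∀ r K t s, ∀ p ∈ Pw r K t s, ∀ b' ∈ suppw r K t s p, ϖPw r K t s p ≤ ϖw r K t s (pos r K t s b'))
    (hϖPw : ∀ r K t s, ∀ p ∈ Pw r K t s, 0 ≤ ϖPw r K t s p) {κwb κcb : ℝ} (hκwb : 0 ≤ κwb) (hκcb : 0 ≤ κcb)
    (hℓwb : ∀ r K t s, ∀ p ∈ Pw r K t s, ∀ ℓ ∈ ℓw r K t s p, ‖ℓ‖ ≤ κwb)
    (hcurlw : ∀ r K t s, ∀ p ∈ Pw r K t s, ‖(ℓw r K t s p).sum‖ ≤ κcb) {mw : ℕ}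
    (hlenw : ∀ r K t s, ∀ p ∈ Pw r K t s, (ℓw r K t s p).length ≤ mw)
    -- the global tuple's real structure with SKEW weight read-outs
    (𝓡𝒴w : ∀ r K (t : ℝ) s, AddSubgroup (Λw r K s → 𝔄w r K s))
    (h𝓡𝒴w : ∀ r K t s, IsClosed (𝓡𝒴w r K t s : Set (Λw r K s → 𝔄w r K s)))
    (𝓡𝒵w : ∀ r K (t : ℝ) s, AddSubgroup (Λz r K s → ℭ r K s)) (𝓡𝒴w' : ∀ r K (t : ℝ) s, AddSubgroup (Λw' r K s → 𝔄' r K s))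
    (𝓡𝒳w : ∀ r K (t : ℝ) s, AddSubgroup (Λx r K s → 𝔅 r K s))
    (h𝓡𝒳w : ∀ r K t s, IsClosed (𝓡𝒳w r K t s : Set (Λx r K s → 𝔅 r K s)))
    (𝓡ℬw : ∀ r K (t : ℝ) s, AddSubgroup (Λb r K s → 𝔇 r K s))
    (h𝒢rw : ∀ r K t s, ∀ V, ∀ f ∈ 𝓡𝒵w r K t s, kerOp (k𝒢 r K t s V) f ∈ 𝓡𝒴w r K t s)
    (hWrw : ∀ r K t s, ∀ V, ∀ Y ∈ 𝓡𝒴w r K t s, W𝒱w r K t s V Y ∈ 𝓡𝒵w r K t s)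
    (hιrw : ∀ r K t s, ∀ V, ∀ Y ∈ 𝓡𝒴w r K t s, kerOp (kι r K t s V) Y ∈ 𝓡𝒴w' r K t s)
    (hHrw : ∀ r K t s, ∀ V, ∀ X ∈ 𝓡𝒳w r K t s, kerOp (kH r K t s V) X ∈ 𝓡𝒴w r K t s)
    (hCrw : ∀ r K t s, ∀ V, ∀ Z ∈ 𝓡𝒴w' r K t s, Cw r K t s V Z ∈ 𝓡𝒳w r K t s)
    (hH₁rw : ∀ r K t s, ∀ V, ∀ B ∈ 𝓡ℬw r K t s, kerOp (kH₁ r K t s V) B ∈ 𝓡𝒴w r K t s)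
    (hΦrw : ∀ r K t s, ∀ V, ∀ y : Fin (m₀ r K s) → ℝ, ‖y‖ ≤ S → Φw r K t s V (cplx y) ∈ 𝓡ℬw r K t s)
    (hskew : ∀ r K t s, ∀ p ∈ Pw r K t s, ∀ ℓ ∈ ℓw r K t s p, ∀ Y ∈ 𝓡𝒴w r K t s, ℓ Y ∈ skewAdjoint (Matrix n n ℂ))
    -- the frozen background plaquettes (N-ne7cp1-g31-2) with a uniform size bound, the located count, `0 ≤ β`
    (Bp : ∀ r K (t : ℝ) s, GaugeField (P r K s) (jl r K s) SU2 → 𝔭 r K s → Matrix n n ℂ) {d : ∀ r K (t : ℝ) s, 𝔭 r K s → ℝ}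
    {dbar : ℝ} (hBu : ∀ r K t s, ∀ V, ∀ p ∈ Pw r K t s, Bp r K t s V p ∈ unitary (Matrix n n ℂ))
    (hBd : ∀ r K t s, ∀ V, ∀ p ∈ Pw r K t s, ‖Bp r K t s V p - 1‖ ≤ d r K t s p)
    (hd : ∀ r K t s, ∀ p ∈ Pw r K t s, d r K t s p ≤ dbar) (hdbar : 0 ≤ dbar) {Kw : ℝ}
    (hKw : ∀ r K t s, ∑ p ∈ Pw r K t s, Real.exp (-(δw * ϖPw r K t s p)) ≤ Kw)
    -- ══ (T3) THE LOCATED NON-WILSON TERMS' SUPPLIER DATA (S71 f2 `hE_landau_chartRay_pinned`): the global tuple' …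
    {Λe : Bool → ℕ → σ → Type*} [∀ r K s, Fintype (Λe r K s)] {𝔄 : Bool → ℕ → σ → Type*} [∀ r K s, NormedAddCommGroup (𝔄 r K s)]
    [∀ r K s, NormedSpace ℂ (𝔄 r K s)] [∀ r K s, CompleteSpace (𝔄 r K s)] {δ' : ℝ} {ϖ : ∀ r K (t : ℝ) s, Λe r K s → ℝ}
    (hδ' : 0 ≤ δ') (hϖ : ∀ r K t s, ∀ b', 0 ≤ ϖ r K t s b') {𝒴e' 𝒳e 𝒵e ℬe : Bool → ℕ → σ → Type*}
    [∀ r K s, NormedAddCommGroup (𝒴e' r K s)] [∀ r K s, NormedSpace ℂ (𝒴e' r K s)] [∀ r K s, NormedAddCommGroup (𝒳e r K s)]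
    [∀ r K s, NormedSpace ℂ (𝒳e r K s)] [∀ r K s, CompleteSpace (𝒳e r K s)] [∀ r K s, NormedAddCommGroup (𝒵e r K s)]
    [∀ r K s, NormedSpace ℂ (𝒵e r K s)] [∀ r K s, NormedAddCommGroup (ℬe r K s)] [∀ r K s, NormedSpace ℂ (ℬe r K s)]
    (𝒢e : ∀ r K t s, GaugeField (P r K s) (jl r K s) SU2 → (𝒵e r K s →L[ℂ] WSup (pinW δ' (ϖ r K t s)) 1 (𝔄 r K s)))
    (W𝒱e : ∀ r K t s, GaugeField (P r K s) (jl r K s) SU2 → WSup (pinW δ' (ϖ r K t s)) 1 (𝔄 r K s) → 𝒵e r K s)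
    {B₀e C₄e a₃e be ε₄e : ℝ} (h𝒢e : ∀ r K t s, ∀ V f, ‖𝒢e r K t s V f‖ ≤ B₀e * ‖f‖)
    (hWe : ∀ r K t s, ∀ V, Prop4Hyp (W𝒱e r K t s V) C₄e a₃e) (hB₀e : 0 < B₀e) (hC₄e : 0 ≤ C₄e) (hbe : 0 ≤ be) (hε₄e : 0 ≤ ε₄e)
    (hdome : 2 * (ε₄e + B₀e * be) ≤ a₃e) (hselfe : B₀e * C₄e * (ε₄e + B₀e * be) ^ 2 ≤ ε₄e)
    (hcontre : 4 * B₀e * C₄e * (ε₄e + B₀e * be) < 1)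
    (H₁e : ∀ r K t s, GaugeField (P r K s) (jl r K s) SU2 → (ℬe r K s →L[ℂ] WSup (pinW δ' (ϖ r K t s)) 1 (𝔄 r K s)))
    (hH₁e : ∀ r K t s, ∀ V B, ‖H₁e r K t s V B‖ ≤ B₀e * ‖B‖)
    (Φe : ∀ r K (t : ℝ) s, GaugeField (P r K s) (jl r K s) SU2 → (Fin (m₀ r K s) → ℂ) → ℬe r K s) {rΦe : ℝ}
    (hΦde : ∀ r K t s, ∀ V, DifferentiableOn ℂ (Φe r K t s V) (ball 0 rΦe)) (hΦ0e : ∀ r K t s, ∀ V, Φe r K t s V 0 = 0)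
    (hΦbe : ∀ r K t s, ∀ V, ∀ z ∈ ball (0 : Fin (m₀ r K s) → ℂ) rΦe, ‖Φe r K t s V z‖ < be) (hSre : S < rΦe)
    (Ce : ∀ r K (t : ℝ) s, GaugeField (P r K s) (jl r K s) SU2 → 𝒴e' r K s → 𝒳e r K s) {C₂e RCe : ℝ} (hC₂e : 0 ≤ C₂e)
    (hCqe : ∀ r K t s, ∀ V, ∀ Z : 𝒴e' r K s, ‖Z‖ < RCe → ‖Ce r K t s V Z‖ ≤ C₂e * ‖Z‖ ^ 2)
    (hCde : ∀ r K t s, ∀ V, DifferentiableOn ℂ (Ce r K t s V) (ball 0 RCe))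
    (ιe : ∀ r K t s, GaugeField (P r K s) (jl r K s) SU2 → (WSup (pinW δ' (ϖ r K t s)) 1 (𝔄 r K s) →L[ℂ] (𝒴e' r K s)))
    (hιe : ∀ r K t s, ∀ V Y, ‖ιe r K t s V Y‖ ≤ ‖Y‖)
    (He : ∀ r K t s, GaugeField (P r K s) (jl r K s) SU2 → (𝒳e r K s →L[ℂ] WSup (pinW δ' (ϖ r K t s)) 1 (𝔄 r K s)))
    (hHe : ∀ r K t s, ∀ V X, ‖He r K t s V X‖ ≤ B₀e * ‖X‖) (hqe : 9 * C₂e * B₀e * (ε₄e + B₀e * be) < 1)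
    (hRCe : 3 * (ε₄e + B₀e * be) ≤ RCe) {𝔱 : Bool → ℕ → σ → Type*} (I : ∀ r K (t : ℝ) s, Finset (𝔱 r K s))
    {Ef : ∀ r K (t : ℝ) s, 𝔱 r K s → (Λe r K s → 𝔄 r K s) → ℂ} {rE : ℝ} {ee : ∀ r K (t : ℝ) s, 𝔱 r K s → ℝ} (hrE : 0 < rE)
    (hEd : ∀ r K t s, ∀ i ∈ I r K t s, DifferentiableOn ℂ (Ef r K t s i) (ball 0 rE))
    (hEb : ∀ r K t s, ∀ i ∈ I r K t s, ∀ Z ∈ ball (0 : Λe r K s → 𝔄 r K s) rE, ‖Ef r K t s i Z‖ ≤ ee r K t s i)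
    (he0 : ∀ r K t s, ∀ i ∈ I r K t s, 0 ≤ ee r K t s i) (supp : ∀ r K (t : ℝ) s, 𝔱 r K s → Finset (Λe r K s))
    (hblind : ∀ r K t s, ∀ i ∈ I r K t s, ∀ A₁ A₂ : Λe r K s → 𝔄 r K s, (∀ b' ∈ supp r K t s i, A₁ b' = A₂ b') → Ef r K t s i A₁
      = Ef r K t s i A₂)
    (ϖP : ∀ r K (t : ℝ) s, 𝔱 r K s → ℝ)
    (hdepth : ∀ r K t s, ∀ i ∈ I r K t s, ∀ b' ∈ supp r K t s i, ϖP r K t s i ≤ ϖ r K t s b') {LK : ℝ} (hLK : 0 ≤ LK)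
    (hK : ∀ r K t s, ∑ i ∈ I r K t s, 2 * ee r K t s i / rE * Real.exp (-(δ' * ϖP r K t s i)) ≤ LK)
    (hcoupE : ((ε₄e + B₀e * be) + B₀e * (4 * C₂e * (ε₄e + B₀e * be) ^ 2)) ≤ rE / 2) {BE₁ : ℝ}
    (hElb₁ : ∀ r K t s, ∀ V (y : Fin (m₀ r K s) → ℝ), ‖y‖ ≤ S → -BE₁ ≤ (∑ i ∈ I r K t s, Ef r K t s i (WSup.toPiL (𝔄 := 𝔄 r K s)
      (pinW δ' (ϖ r K t s)) 1 (landauExp (Ce r K t s V) (ιe r K t s V) (He r K t s V) (4 * C₂e * (ε₄e + B₀e * be) ^ 2) (solAt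
      (𝒢e r K t s V) 0 (W𝒱e r K t s V) ε₄e (0 : 𝒵e r K s) (H₁e r K t s V (Φe r K t s V (cplx y))) + H₁e r K t s V (Φe r K t s V
      (cplx y)))))).re)
    -- ══ (S78) THE FLUCTUATION-DRESSED TERMS: `−log ∫ g e^{A} dμ` with an ω-UNIFORM ray constant `B_d`, integrabi …
    {Ω : Bool → ℕ → σ → Type*} [∀ r K s, MeasurableSpace (Ω r K s)] (μ : ∀ r K (t : ℝ) s, Measure (Ω r K s))
    {g : ∀ r K (t : ℝ) s, Ω r K s → ℝ} (hg : ∀ r K t s, ∀ ω, 0 ≤ g r K t s ω)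
    (Aex : ∀ r K (t : ℝ) s, GaugeField (P r K s) (jl r K s) SU2 → (Fin (m₀ r K s) → ℝ) → Ω r K s → ℝ) {Bd : ℝ} (hBd0 : 0 ≤ Bd)
    (hint : ∀ r K t s, ∀ V, ∀ x ∈ W r K t s V, ∀ c : ℝ, 1 / 2 ≤ c → c ≤ 1 → Integrable (fun ω => g r K t s ω * Real.exp (Aex r K
      t s V (c • x) ω)) (μ r K t s))
    (hpos : ∀ r K t s, ∀ V, ∀ x ∈ W r K t s V, ∀ c : ℝ, 1 / 2 ≤ c → c ≤ 1 → 0 < ∫ ω, g r K t s ω * Real.exp (Aex r K t s V (c •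
      x) ω) ∂(μ r K t s))
    (hA : ∀ r K t s, ∀ V, ∀ x ∈ W r K t s V, ∀ c : ℝ, 1 / 2 ≤ c → c ≤ 1 → ∀ ω, Aex r K t s V x ω ≤ Aex r K t s V (c • x) ω + (1
      - c) * Bd)
    {BE₂ : ℝ}
    (hElb₂ : ∀ r K t s, ∀ V (y : Fin (m₀ r K s) → ℝ), ‖y‖ ≤ S → -BE₂ ≤ (-Real.log (∫ ω, g r K t s ω * Real.exp (Aex r K t s V y
      ω) ∂(μ r K t s))))
    (L : ∀ r K (t : ℝ) s, Set (𝒴 r K s →L[ℂ] Matrix n n ℂ)) (𝓡𝒵 : ∀ r K (t : ℝ) s, AddSubgroup (𝒵 r K s))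
    (𝓡𝒴' : ∀ r K (t : ℝ) s, AddSubgroup (𝒴' r K s)) (𝓡𝒳 : ∀ r K (t : ℝ) s, AddSubgroup (𝒳 r K s))
    (h𝓡𝒳 : ∀ r K t s, IsClosed (𝓡𝒳 r K t s : Set (𝒳 r K s))) (𝓡ℬ : ∀ r K (t : ℝ) s, AddSubgroup (ℬ r K s))
    (h𝒢r : ∀ r K t s, ∀ V, ∀ f ∈ 𝓡𝒵 r K t s, 𝒢 r K t s V f ∈ readOutReal (L r K t s))
    (hWr : ∀ r K t s, ∀ V, ∀ Y ∈ readOutReal (L r K t s), W𝒱 r K t s V Y ∈ 𝓡𝒵 r K t s)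
    (hιr : ∀ r K t s, ∀ V, ∀ Y ∈ readOutReal (L r K t s), ιs r K t s V Y ∈ 𝓡𝒴' r K t s)
    (hHr : ∀ r K t s, ∀ V, ∀ X ∈ 𝓡𝒳 r K t s, Hop r K t s V X ∈ readOutReal (L r K t s))
    (hCr : ∀ r K t s, ∀ V, ∀ Z ∈ 𝓡𝒴' r K t s, Cf r K t s V Z ∈ 𝓡𝒳 r K t s)
    (hH₁r : ∀ r K t s, ∀ V, ∀ B ∈ 𝓡ℬ r K t s, H₁ r K t s V B ∈ readOutReal (L r K t s))
    (hΦr : ∀ r K t s, ∀ V, ∀ y : Fin (m₀ r K s) → ℝ, ‖y‖ ≤ S → Φ r K t s V (cplx y) ∈ 𝓡ℬ r K t s)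
    (hRdict : ∀ r K t s, ∀ V, ∀ x ∈ cube (m₀ r K s) S, F r K t s (fixTo (Tr r K s) (U₀ r K t s) (updateFinset V (Λ r K s)
      (expFibreChart (Λ r K s) (ctr r K t s V) (e r K s) x))) = Jco r K t s V x * ENNReal.ofReal (Real.exp (-((∑ p ∈ Pw r K t s,
      β r (jl r K s) * (1 - (Matrix.trace (Bp r K t s V p * holOf (ℓw r K t s p) (fun y => landauExp (Cw r K t s V) (kerOp (kι r
      K t s V)) (kerOp (kH r K t s V)) (4 * C₂w * (ε₄w + B₀w * bw) ^ 2) (solAt (kerOp (k𝒢 r K t s V)) 0 (W𝒱w r K t s V) ε₄w (0 :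
      Λz r K s → ℭ r K s) (kerOp (kH₁ r K t s V) (Φw r K t s V (cplx y))) + kerOp (kH₁ r K t s V) (Φw r K t s V (cplx y))))
      x)).re / Fintype.card n)) + ((∑ i ∈ I r K t s, Ef r K t s i (WSup.toPiL (𝔄 := 𝔄 r K s) (pinW δ' (ϖ r K t s)) 1 (landauExp
      (Ce r K t s V) (ιe r K t s V) (He r K t s V) (4 * C₂e * (ε₄e + B₀e * be) ^ 2) (solAt (𝒢e r K t s V) 0 (W𝒱e r K t s V) ε₄e
      (0 : 𝒵e r K s) (H₁e r K t s V (Φe r K t s V (cplx x))) + H₁e r K t s V (Φe r K t s V (cplx x)))))).re + (-Real.log (∫ ω, g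
      r K t s ω * Real.exp (Aex r K t s V x ω) ∂(μ r K t s))))))))
    (hudict : ∀ r K t s, ∀ V, ∀ x ∈ cube (m₀ r K s) S, u r K t s (fixTo (Tr r K s) (U₀ r K t s) (updateFinset V (Λ r K s)
      (expFibreChart (Λ r K s) (ctr r K t s V) (e r K s) x))) = classifier (hPu r K t s) (fun p => holOf (ℓs r K t s p) (fun y
      => landauExp (Cf r K t s V) (ιs r K t s V) (Hop r K t s V) (4 * C₂ * (ε₄ + B₀ * (2 * dL * C₁ * ε₁)) ^ 2) (solAt (𝒢 r K t s
      V) 0 (W𝒱 r K t s V) ε₄ (0 : 𝒵 r K s) (H₁ r K t s V (Φ r K t s V (cplx y))) + H₁ r K t s V (Φ r K t s V (cplx y))))) x)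
    (hJW : ∀ r K t s, ∀ V x, Jco r K t s V x ≠ 0 → x ∈ W r K t s V)
    (hJ : ∀ r K t s, ∀ V x, ∀ a : ℝ, 0 ≤ a → Jco r K t s V x ≤ Jco r K t s V (Real.exp (-a) • x))
    (hJ1 : ∀ r K t s, ∀ V x, Jco r K t s V x ≤ 1) (hWS : ∀ r K t s, ∀ V, W r K t s V ⊆ closedBall (0 : Fin (m₀ r K s) → ℝ) S)
    (hδ0 : 0 ≤ δ) (hδ1 : δ < 1)
    -- SM-L2 (SM) DISCHARGED IN THE STOKES CURRENCY (S73 `hSM_of_stokes`): the η-scalings of the classifier's read …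
    {c₁ c₂ zs : ℝ}
    (hs₁ : ∀ r K s, κc * ((ε₄ + B₀ * (2 * dL * C₁ * ε₁)) + B₀ * (4 * C₂ * (ε₄ + B₀ * (2 * dL * C₁ * ε₁)) ^ 2)) ≤ c₁ * η r (jl r
      K s) ^ 2 * zs)
    (ha : ∀ r K s, κr * ((ε₄ + B₀ * (2 * dL * C₁ * ε₁)) + B₀ * (4 * C₂ * (ε₄ + B₀ * (2 * dL * C₁ * ε₁)) ^ 2)) ≤ c₂ * η r (jl r K
      s) * zs)
    (hma : m * (κr * ((ε₄ + B₀ * (2 * dL * C₁ * ε₁)) + B₀ * (4 * C₂ * (ε₄ + B₀ * (2 * dL * C₁ * ε₁)) ^ 2))) ≤ 1)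
    (hsm : ∀ r K s, 36 * (c₁ * zs + m ^ 2 * c₂ ^ 2 * zs ^ 2) / (rΦ / S - 1) ^ 2 ≤ δ * ε r (K - lvl r K s))
    (hρ : ∀ r j, ρ r j ≤ (1 - δ) / 2) (hβ : ∀ r j, 0 ≤ β r j)
    :
    ∀ (r : Bool) (K : ℕ) (t : ℝ) (s : σ), SlotAntiConcentration ((fieldMeasure (P r K s) (jl r K s) SU2).withDensity (F r K t
      s)) (fun U => u r K t s U / η r (jl r K s) ^ 2) (ε r (K - lvl r K s)) (ρ r (lvl r K s)) (2 * ((m₀ r K s : ℝ) + (3 * (|β r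
      (jl r K s)| * ((dbar + 2 * (κcb * (cH₁ * MH₁ * bw / ((1 - c𝒢 * M𝒢 * (2 * C₄w * a₃w * Real.exp (δw * rW))) * (1 - 2 * C₂w *
      RCw * Real.exp (δw * rC) * (cι * Mι) * (cH * MH)))) + expTail₂ (mw * (κwb * (cH₁ * MH₁ * bw / ((1 - c𝒢 * M𝒢 * (2 * C₄w *
      a₃w * Real.exp (δw * rW))) * (1 - 2 * C₂w * RCw * Real.exp (δw * rC) * (cι * Mι) * (cH * MH))))))) / (rΦw / S)) * (2 *
      (κcb * (cH₁ * MH₁ * bw / ((1 - c𝒢 * M𝒢 * (2 * C₄w * a₃w * Real.exp (δw * rW))) * (1 - 2 * C₂w * RCw * Real.exp (δw * rC) *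
      (cι * Mι) * (cH * MH)))) + expTail₂ (mw * (κwb * (cH₁ * MH₁ * bw / ((1 - c𝒢 * M𝒢 * (2 * C₄w * a₃w * Real.exp (δw * rW))) *
      (1 - 2 * C₂w * RCw * Real.exp (δw * rC) * (cι * Mι) * (cH * MH))))))) / (rΦw / S))) * Kw) + (3 * (LK * (2 * ((ε₄e + B₀e *
      be) + B₀e * (4 * C₂e * (ε₄e + B₀e * be) ^ 2)))) / (rΦe / S - 1) + Bd))) / (1 - δ)) :=
  fun r K t s => slotAntiConcentration_thresholdUnits (hη r (jl r K s))
    (slotAC_realized_su2_landauChart_assembled_decay (hT r K s) (U₀ r K t s) (Λ r K s) (e r K s) hS hSπ (ctr r K t s) (hF r K t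
      s) (hFi r K t s) (hFsupp r K t s) (hu r K t s) (hui r K t s) (hPu r K t s) (W r K t s) (Jco r K t s) (𝒢 r K t s) (W𝒱 r K t
      s) (h𝒢 r K t s) (hW r K t s) hB₀ hC₄ hε₄ hdL hC₁ hε₁ hB₃ h1 h2 h3 (H₁ r K t s) (hH₁ r K t s) (Φ r K t s) (hΦd r K t s)
      (hΦ0 r K t s) (hΦ r K t s) hSr (Cf r K t s) hC₂ (hCq r K t s) (hCd r K t s) (ιs r K t s) (hι r K t s) (Hop r K t s) (hH r
      K t s) h18 hcoup h3R (ℓs r K t s) hκ (hℓ r K t s) (hlen r K t s) hκc (hcurl r K t s) hδw (ϖw r K t s) (dis r K t s) (hϖw r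
      K t s) (pos r K t s) (posz r K t s) (pos' r K t s) (posx r K t s) (posb r K t s) (k𝒢 r K t s) (kι r K t s) (kH r K t s)
      (kH₁ r K t s) hc𝒢 hM𝒢 (hk𝒢 r K t s) (hM𝒢' r K t s) hcι hMι (hkι r K t s) (hMι' r K t s) hcH hMH (hkH r K t s) (hMH' r K t
      s) hcH₁ hMH₁ (hkH₁ r K t s) (hMH₁' r K t s) (W𝒱w r K t s) (h𝒢w r K t s) (hWw r K t s) hB₀w hC₄w hε₄w hdomw hselfw hcontrw
      (hH₁w r K t s) (Φw r K t s) (hΦdw r K t s) (hΦ0w r K t s) (hΦbw r K t s) h2Sw (Cw r K t s) hC₂w (hCqw r K t s) (hCdw r K t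
      s) (hιw r K t s) (hHw r K t s) hqw hRCw (NW r K t s) (hlocW r K t s) (hreachW r K t s) (NC r K t s) (hlocC r K t s)
      (hreachC r K t s) (hsupp r K t s) hqW hk (Pw r K t s) (ℓw r K t s) (suppw r K t s) (ϖPw r K t s) (hblindw r K t s)
      (hdepthw r K t s) (hϖPw r K t s) hκwb hκcb (hℓwb r K t s) (hcurlw r K t s) (hlenw r K t s) (𝓡𝒴w r K t s) (h𝓡𝒴w r K t s)
      (𝓡𝒵w r K t s) (𝓡𝒴w' r K t s) (𝓡𝒳w r K t s) (h𝓡𝒳w r K t s) (𝓡ℬw r K t s) (h𝒢rw r K t s) (hWrw r K t s) (hιrw r K t s) (hHrw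
      r K t s) (hCrw r K t s) (hH₁rw r K t s) (hΦrw r K t s) (hskew r K t s) (Bp r K t s) (hBu r K t s) (hBd r K t s) (hd r K t
      s) hdbar (hKw r K t s) hδ' (hϖ r K t s) (𝒢e r K t s) (W𝒱e r K t s) (h𝒢e r K t s) (hWe r K t s) hB₀e hC₄e hbe hε₄e hdome
      hselfe hcontre (H₁e r K t s) (hH₁e r K t s) (Φe r K t s) (hΦde r K t s) (hΦ0e r K t s) (hΦbe r K t s) hSre (Ce r K t s)
      hC₂e (hCqe r K t s) (hCde r K t s) (ιe r K t s) (hιe r K t s) (He r K t s) (hHe r K t s) hqe hRCe (I r K t s) hrE (hEd r K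
      t s) (hEb r K t s) (he0 r K t s) (supp r K t s) (hblind r K t s) (ϖP r K t s) (hdepth r K t s) hLK (hK r K t s) hcoupE
      (hElb₁ r K t s) (μ r K t s) (hg r K t s) (Aex r K t s) hBd0 (hint r K t s) (hpos r K t s) (hA r K t s) (hElb₂ r K t s) (L
      r K t s) (𝓡𝒵 r K t s) (𝓡𝒴' r K t s) (𝓡𝒳 r K t s) (h𝓡𝒳 r K t s) (𝓡ℬ r K t s) (h𝒢r r K t s) (hWr r K t s) (hιr r K t s) (hHr
      r K t s) (hCr r K t s) (hH₁r r K t s) (hΦr r K t s) (hRdict r K t s) (hudict r K t s) (hJW r K t s) (hJ r K t s) (hJ1 r K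
      t s) (hWS r K t s) hδ0 hδ1 (hρ0 r (lvl r K s)) (hρ r (lvl r K s)) (hβ r (jl r K s)) (hη r (jl r K s)) (hε r (K - lvl r K
      s)) (hs₁ r K s) (ha r K s) hma (hsm r K s))

end Summit.QuantumFields.BalabanUV.T4Continuum.ShellMeasureLiveEndOneCallSlot

end
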